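import Summits.ResolutionOfSingularities.ResolutionOfSingularities.Theses.PAlteration
import Literature.AlgebraicGeometry.Resolution.AbsoluteIntegralClosureNoResolution

/-!
# `Pialt` — negative lemmas II: finite type is load-bearing

Support (negative) lemmas for crux `stmt-ResolutionOfSingularities-0555`
(`Summit.ResolutionOfSingularities.ResolutionOfSingularities.Theses.PAlteration.Pialt`: for every
prime `p`, every integral separated finite-type `X / k` with `char k = p` has a proper surjective
`g : X' → X` from an integral regular `X'`, finite and universally injective over a dense open of
`X` — a purely inseparable regular alteration; Abramovich–Oort 2000 Q. 2.13 = Temkin 2013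
Conj. 1.3.1, positive-characteristic slice), filed by the standing disprover (cdisprove gen 1; work
file `Cruxes/Pialt/Disproof.lean`). This file declares NO definition: every variant statement is
written out inline, and NO declaration concludes the route decl `Pialt` positively.

* `not_surjective_of_isIntegral_of_isNoetherianRing_stalk` — NO integral scheme with Noetherian
  stalks surjects onto `Spec R` when every element of the domain `R` is a square and `R` has a
  non-zero prime (iterated square roots of `0 ≠ q ∈ Q` pull back to sections whose germs at a
  point over `Q` are non-units, so the germ of `g*q` lies in `⋂ₙ 𝔪ⁿ = 0` by Krull; germs of an
  integral scheme are injective, so `g*q = 0`, `g⁻¹ D(q) = ∅`, and surjectivity gives `D(q) = ∅`,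
  `q` nilpotent, `q = 0`).
* `pialt_false_without_locallyOfFiniteType_at` / `pialt_false_without_locallyOfFiniteType` — with
  `LocallyOfFiniteType f` dropped the crux is FALSE at every prime: `Spec 𝔽_p[X]⁺ → Spec 𝔽_p`
  (absolute integral closure of the affine line; affine, integral; the tree's witness of
  `AbsoluteIntegralClosureNoResolution.lean`) admits no surjection from an integral scheme with
  Noetherian stalks, let alone a purely inseparable regular alteration — so neither properness,
  finiteness nor radiciality is needed to kill it, and any proof of the crux must use the finite
  type of `X → Spec k` already to produce a surjection from a scheme with Noetherian local rings.

## Sources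
* M. Artin, *On the joins of Hensel rings*, Adv. Math. 7 (1971) 282–296 (absolute integral
  closure); the Noetherian/root-closed argument is folklore (Krull's intersection theorem).
* The Stacks Project, Tag 00FZ (lying over), Tag 02IS (regular schemes).
-/

noncomputable section

-- single-problem summit: the doubled namespace component `ResolutionOfSingularities` is forced
set_option linter.dupNamespace false

open CategoryTheory AlgebraicGeometry TopologicalSpace Topology Polynomial
open Literature.AlgebraicGeometry.Resolution

namespace Summit.ResolutionOfSingularities.ResolutionOfSingularities.Theorems.Pialt.Negative

open Summit.ResolutionOfSingularities.ResolutionOfSingularities.Theses.PAlteration (Pialt)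

/-- **No integral scheme with Noetherian stalks surjects onto the spectrum of a root-closed
domain with a non-zero prime.** If every element of the domain `R` is a square and `Q ≠ 0` is a
prime, `X'` is integral with Noetherian local rings and `g : X' → Spec R` hits `Q`, say at `x`,
then for `0 ≠ q ∈ Q` with iterated square roots `bₙ` (`bₙ ^ 2ⁿ = q`, all in `Q`) the germs at `x`
of the pulled-back sections `g*(bₙ)` are non-units, so the germ of `g*(q)` lies in `⋂ₙ 𝔪ₓⁿ = 0`
(Krull); as `X'` is integral, `g*(q) = 0`, so `g⁻¹ D(q) = ∅`, and surjectivity forces `D(q) = ∅`,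
i.e. `q` nilpotent, `q = 0`. [folklore] -/
theorem not_surjective_of_isIntegral_of_isNoetherianRing_stalk {R : Type} [CommRing R] [IsDomain R]
    (hsq : ∀ a : R, ∃ b : R, b ^ 2 = a) {Q : Ideal R} (hQp : Q.IsPrime) (hQ : Q ≠ ⊥)
    {X' : Scheme.{0}} [IsIntegral X'] (hN : ∀ x : X', IsNoetherianRing (X'.presheaf.stalk x))
    (g : X' ⟶ Spec (.of R)) : ¬ Function.Surjective g.base := by
  intro hsurj
  -- a non-zero element of `Q` and its iterated square roots
  obtain ⟨q, hqQ, hq0⟩ := Submodule.exists_mem_ne_zero_of_ne_bot hQ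
  choose sq hsq using hsq
  let b : ℕ → R := fun n => Nat.rec q (fun _ c => sq c) n
  have hb0 : b 0 = q := rfl
  have hbsucc : ∀ n, b (n + 1) = sq (b n) := fun n => rfl
  have hbpow : ∀ n, (b n) ^ (2 ^ n) = q := by
    intro n
    induction n with
    | zero => simp [hb0]
    | succ n ih => rw [pow_succ, pow_mul', hbsucc, hsq, ih]
  have hbQ : ∀ n, b n ∈ Q := fun n => hQp.mem_of_pow_mem (2 ^ n) (by rw [hbpow]; exact hqQ)
  -- the point of `X'` over `Q`
  let y : ↥(Spec (.of R)) := (⟨Q, hQp⟩ : PrimeSpectrum R)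
  obtain ⟨x, hx⟩ := hsurj y
  -- the pulled-back sections
  let r : ℕ → Γ(Spec (.of R), ⊤) := fun n => (Scheme.ΓSpecIso (.of R)).inv (b n)
  let t : ℕ → Γ(X', ⊤) := fun n => g.appTop (r n)
  have htpow : ∀ n, (t n) ^ (2 ^ n) = t 0 := by
    intro n
    simp only [t, r, ← map_pow, hbpow, hb0]
  -- `x ∉ X'.basicOpen (t n)` because `bₙ ∈ Q = g x`
  have hxnot : ∀ n, x ∉ X'.basicOpen (t n) := by
    intro n hxmem
    rw [← Scheme.preimage_basicOpen_top] at hxmem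
    have h2 : g.base x ∈ (Spec (.of R)).basicOpen (r n) := hxmem
    rw [hx, basicOpen_eq_of_affine] at h2
    exact (PrimeSpectrum.mem_basicOpen _ _).mp h2 (hbQ n)
  -- hence the germs are non-units and the germ of `t 0` is in every power of the maximal ideal
  have hgerm_mem : ∀ n, X'.presheaf.germ ⊤ x trivial (t n) ∈
      IsLocalRing.maximalIdeal (X'.presheaf.stalk x) := by
    intro n
    rw [IsLocalRing.mem_maximalIdeal, mem_nonunits_iff]
    exact fun hu => hxnot n ((Scheme.mem_basicOpen_top _ _ _).mpr hu)
  have hgerm0 : X'.presheaf.germ ⊤ x trivial (t 0) ∈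
      ⨅ n : ℕ, IsLocalRing.maximalIdeal (X'.presheaf.stalk x) ^ n := by
    refine Submodule.mem_iInf _ |>.mpr fun n => ?_
    have h1 : X'.presheaf.germ ⊤ x trivial (t 0) = (X'.presheaf.germ ⊤ x trivial (t n)) ^ (2 ^ n) := by
      rw [← map_pow, htpow]
    rw [h1]
    exact Ideal.pow_le_pow_right Nat.lt_two_pow_self.le (Ideal.pow_mem_pow (hgerm_mem n) _)
  haveI := hN x
  rw [Ideal.iInf_pow_eq_bot_of_isLocalRing _ (IsLocalRing.maximalIdeal.isMaximal _).ne_top,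
    Ideal.mem_bot] at hgerm0
  -- so `t 0 = g*(q) = 0` (germs of an integral scheme are injective)
  have ht0 : t 0 = 0 :=
    germ_injective_of_isIntegral X' (U := ⊤) x trivial (by rw [hgerm0, map_zero])
  -- `D(q)` is empty: its preimage is `X'.basicOpen 0 = ∅` and `g` is surjective
  have hpre : g ⁻¹ᵁ (Spec (.of R)).basicOpen (r 0) = ⊥ := by
    rw [Scheme.preimage_basicOpen_top]
    show X'.basicOpen (t 0) = ⊥
    rw [ht0, Scheme.basicOpen_zero]
  have hD' : (Spec (.of R)).basicOpen (r 0) = ⊥ := by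
    ext z
    simp only [TopologicalSpace.Opens.coe_bot, Set.mem_empty_iff_false, iff_false]
    intro hz
    obtain ⟨w, hw⟩ := hsurj z
    have hw' : w ∈ g ⁻¹ᵁ (Spec (.of R)).basicOpen (r 0) := by
      show g.base w ∈ ((Spec (.of R)).basicOpen (r 0) : Set _)
      rw [hw]; exact hz
    rw [hpre] at hw'
    exact hw'
  have hD : PrimeSpectrum.basicOpen (R := R) q = ⊥ := by
    have h1 := hD'
    simp only [r] at h1
    rw [basicOpen_eq_of_affine] at h1
    exact h1
  rw [PrimeSpectrum.basicOpen_eq_bot_iff] at hD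
  exact hq0 hD.eq_zero

open Polynomial in
/-- **`LocallyOfFiniteType` is load-bearing**, at every prime `p`: with it dropped the crux fails
at `Spec 𝔽_p[X]⁺ → Spec 𝔽_p` (affine: separated, quasi-compact; integral), which admits no
surjection from an integral scheme with Noetherian stalks
(`not_surjective_of_isIntegral_of_isNoetherianRing_stalk` with the tree's
`absoluteIntegralClosure_exists_sq_eq` / `absoluteIntegralClosure_exists_prime_not_mem`).
[folklore] -/
theorem pialt_false_without_locallyOfFiniteType_at (p : ℕ) [Fact p.Prime] :
    ¬ ∀ (k : Type) [Field k] [CharP k p] (X : Scheme.{0}) (f : X ⟶ Spec (.of k)),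
      IsSeparated f → QuasiCompact f → IsIntegral X →
        ∃ (X' : Scheme.{0}) (g : X' ⟶ X), IsProper g ∧ IsIntegral X' ∧
          Scheme.IsRegular X' ∧ Function.Surjective g.base ∧
            ∃ U : X.Opens, Dense (U : Set X) ∧ IsFinite (g ∣_ U) ∧
              UniversallyInjective (g ∣_ U) := by
  intro h
  let f : Spec (.of ↥(integralClosure (ZMod p)[X] (AlgebraicClosure (RatFunc (ZMod p))))) ⟶
      Spec (.of (ZMod p)) :=
    Spec.map (CommRingCat.ofHom ((algebraMap (ZMod p)[X]
      ↥(integralClosure (ZMod p)[X] (AlgebraicClosure (RatFunc (ZMod p))))).comp Polynomial.C))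
  obtain ⟨X', g, -, hint, hreg, hsurj, -⟩ := h (ZMod p) _ f inferInstance inferInstance inferInstance
  -- a non-zero prime of `𝔽_p[X]⁺`: one avoiding the (non-zero) image of `X`
  have hX0 : algebraMap (ZMod p)[X]
      ↥(integralClosure (ZMod p)[X] (AlgebraicClosure (RatFunc (ZMod p)))) Polynomial.X ≠ 0 :=
    fun h0 => Polynomial.X_ne_zero
      ((absoluteIntegralClosure_algebraMap_injective p) (h0.trans (map_zero _).symm))
  obtain ⟨Q, hQp, hQ, -⟩ := absoluteIntegralClosure_exists_prime_not_mem p _ hX0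
  exact not_surjective_of_isIntegral_of_isNoetherianRing_stalk (absoluteIntegralClosure_exists_sq_eq p)
    hQp hQ (fun x => by haveI := hreg x; infer_instance) g hsurj

/-- **`LocallyOfFiniteType` is load-bearing** (all primes quantified, the crux's own shape with the
finite-type hypothesis deleted). [folklore] -/
theorem pialt_false_without_locallyOfFiniteType :
    ¬ ∀ p : ℕ, p.Prime → ∀ (k : Type) [Field k] [CharP k p] (X : Scheme.{0})
      (f : X ⟶ Spec (.of k)), IsSeparated f → QuasiCompact f → IsIntegral X →
        ∃ (X' : Scheme.{0}) (g : X' ⟶ X), IsProper g ∧ IsIntegral X' ∧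
          Scheme.IsRegular X' ∧ Function.Surjective g.base ∧
            ∃ U : X.Opens, Dense (U : Set X) ∧ IsFinite (g ∣_ U) ∧
              UniversallyInjective (g ∣_ U) :=
  fun h => pialt_false_without_locallyOfFiniteType_at 2
    (fun k _ _ X f hs hq hi => h 2 Nat.prime_two k X f hs hq hi)

end Summit.ResolutionOfSingularities.ResolutionOfSingularities.Theorems.Pialt.Negative

end
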